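import Summits.Ventures.HSemireg.WeilFrameSlopeInfinity
import Summits.Ventures.HSemireg.Mod4ConfluentSpectrum

/-!
# Venture HSemireg — the CONFLUENT member of TABLE R's `ρ(f) = 2` row on the real carrier, every `n ≥ 2`:
# `v = (A + B·m-weighted) e^{λh} + w`, `q_m = (A + B m) λ^m` — side degrees `4C(2n,m) − 4C(n,m)`, middle `4C(2n,n) − 4`, NO box locus

HONEST FRAMING. Part of the Lean index of the computation cell `pub-hsemireg` (seat w3-mod4-1 gen 9, W3 SPECIAL FIBRES;
MOD4-OFFSPLIT TABLE R «confluent (double slope): `P_n(t)² + 2tⁿ` only», COROLLARY S′). The tree's real carriers and the Literature's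
Weil-type layer ONLY: no semiregularity map, no Ext group, no `∫`; nothing here says that HC / HC_CM / HC_AV holds; nothing here is a
claim about any explicit variety; no Literature fact is declared; NO definition is introduced. Independent of the unbuilt `Mod4Carrier*`
modules (imports FILE 27 and FILE 28).

WHAT IS PROVED (hypotheses of `finrank_S_weilType_middle`; `q_m = (A + B m) λ^m` with `B ≠ 0`, `λ ≠ 0`; pin `(2n)!·(ĉ₊ĉ₋) = t·ĥ^{2n}`):
**`finrank_S_confluent_deg`** — `dim S_m(x) + 4C(n,m) = 4C(2n,m)` (`1 ≤ m ≤ n - 1`; `r_m = 2` by `Mod4.hankel1_rank_confluent`);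
**`finrank_S_confluent_middle`** — `dim S_n(x) + 4 = 4C(2n,n)` for EVERY pin (`n ≥ 2`; `Mod4.finrank_ker_middleM_confluent`, the pin
being non-zero by `pin_ne_zero_weilType`): the confluent h-part never meets the box locus. Everything PROVED, 0 sorry.
References: [BuchweitzFlenner2008HH] Prop. 6.4.4; [vanGeemen1994HodgeAV] 4.9; [BourbakiAlgebre1a3] Ch. III §8, §11 no. 9.
-/

noncomputable section

open CliffordAlgebra (contractLeft)
open ExteriorAlgebra (ι)
open Module CategoryTheory
open Literature.AlgebraicGeometry.Motives Literature.AlgebraicGeometry.HodgeTheory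
open Literature.AlgebraicTopology.SingularHomology

namespace Summit.Ventures.HSemireg.WeilFrame

open Summit.Ventures.HSemireg.WedgeBridge Summit.Ventures.HSemireg.WeilCarrier Summit.Ventures.HSemireg.Mod4Carrier
open Summit.Ventures.HSemireg.Wedge.Hankel

section RealCarrier

variable {A : AbelianVariety ℂ}

/-- **confluent h-part, lower side degrees on the real carrier** (`1 ≤ m ≤ n - 1`): `dim S_m(x) + 4C(n,m) = 4C(2n,m)`.
[cite: BuchweitzFlenner2008HH, Prop. 6.4.4] -/
theorem finrank_S_confluent_deg (hA : IsSmoothProjective A.dim A.X) {n d : ℕ} (hdim : A.dim = n + n) (hd : 0 < d)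
    {φ : A ⟶ A} (hφ : φ ≫ φ = -(d • 𝟙 A)) {P Q : Submodule ℂ (complexBetti A.X 1)}
    (hP : P = Module.End.eigenspace (complexBetti.map φ.hom.hom.hom 1).hom (Complex.I * (Real.sqrt d : ℂ)))
    (hQ : Q = Module.End.eigenspace (complexBetti.map φ.hom.hom.hom 1).hom (-(Complex.I * (Real.sqrt d : ℂ))))
    (hp : finrank ℂ ↥(P ⊓ hodgeOneZero hA) = n) {h : complexBetti A.X 2}
    (hh : complexBetti.map φ.hom.hom.hom 2 h = (d : ℂ) • h) (h11 : IsOfHodgeType A.dim A.X 2 1 1 h)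
    (hvol : ((⋀[ℂ]^2 (complexBetti A.X 1)).subtype ((abelianVarietyCohomologyExteriorH1_holds.equiv A 2).symm h)) ^ (n + n) ≠ 0)
    {cP cQ : complexBetti A.X (2 * n)} (hcP : cP ∈ weilClassesPlus A φ n d) (hcP0 : cP ≠ 0)
    (hcQ : cQ ∈ weilClassesMinus A φ n d) (hcQ0 : cQ ≠ 0)
    (Aₛ : ℂ) {Bₛ la : ℂ} (hBs : Bₛ ≠ 0) (hla : la ≠ 0) {m : ℕ} (hm1 : 1 ≤ m) (hmn : m + 1 ≤ n) :
    finrank ℂ ↥(S ℂ (hodgeZeroOne hA) m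
        ((∑ m ∈ Finset.range (n + n + 1), (((Aₛ + Bₛ * (m : ℂ)) * la ^ m) * ((m.factorial : ℕ) : ℂ)⁻¹) •
            ((⋀[ℂ]^2 (complexBetti A.X 1)).subtype ((abelianVarietyCohomologyExteriorH1_holds.equiv A 2).symm h)) ^ m) +
          (⋀[ℂ]^(2 * n) (complexBetti A.X 1)).subtype ((abelianVarietyCohomologyExteriorH1_holds.equiv A (2 * n)).symm cP) +
          (⋀[ℂ]^(2 * n) (complexBetti A.X 1)).subtype ((abelianVarietyCohomologyExteriorH1_holds.equiv A (2 * n)).symm cQ))) + 4 * n.choose m = 4 * (n + n).choose m := by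
  haveI : Module.Finite ℂ (complexBetti A.X 1) := abelianVarietyCohomologyExteriorH1_holds.finite_one A
  have h : finrank ℂ ↥(S ℂ (hodgeZeroOne hA) m
        ((∑ m ∈ Finset.range (n + n + 1), (((Aₛ + Bₛ * (m : ℂ)) * la ^ m) * ((m.factorial : ℕ) : ℂ)⁻¹) •
            ((⋀[ℂ]^2 (complexBetti A.X 1)).subtype ((abelianVarietyCohomologyExteriorH1_holds.equiv A 2).symm h)) ^ m) +
          (⋀[ℂ]^(2 * n) (complexBetti A.X 1)).subtype ((abelianVarietyCohomologyExteriorH1_holds.equiv A (2 * n)).symm cP) +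
          (⋀[ℂ]^(2 * n) (complexBetti A.X 1)).subtype ((abelianVarietyCohomologyExteriorH1_holds.equiv A (2 * n)).symm cQ))) +
        (n.choose m + n.choose m) * (hankel1 ℂ (n + n) m (fun m => (Aₛ + Bₛ * (m : ℂ)) * la ^ m)).rank =
      (n + n).choose m + (n + n).choose m + (n + n).choose m * (hankel1 ℂ (n + n) m (fun m => (Aₛ + Bₛ * (m : ℂ)) * la ^ m)).rank :=
    finrank_S_weilType_deg hA hdim hd hφ hP hQ hp hh h11 hvol hcP hcP0 hcQ hcQ0 (fun m => (Aₛ + Bₛ * (m : ℂ)) * la ^ m) hm1 hmn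
  rw [Mod4.hankel1_rank_confluent hm1 (by omega) Aₛ hBs hla] at h
  omega

/-- **confluent h-part, middle degree on the real carrier, EVERY pin** (`n ≥ 2`): `dim S_n(x) + 4 = 4C(2n,n)` — no box locus.
[cite: BuchweitzFlenner2008HH, Prop. 6.4.4] -/
theorem finrank_S_confluent_middle (hA : IsSmoothProjective A.dim A.X) {n d : ℕ} (hdim : A.dim = n + n) (hd : 0 < d)
    {φ : A ⟶ A} (hφ : φ ≫ φ = -(d • 𝟙 A)) {P Q : Submodule ℂ (complexBetti A.X 1)}
    (hP : P = Module.End.eigenspace (complexBetti.map φ.hom.hom.hom 1).hom (Complex.I * (Real.sqrt d : ℂ)))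
    (hQ : Q = Module.End.eigenspace (complexBetti.map φ.hom.hom.hom 1).hom (-(Complex.I * (Real.sqrt d : ℂ))))
    (hp : finrank ℂ ↥(P ⊓ hodgeOneZero hA) = n) {h : complexBetti A.X 2}
    (hh : complexBetti.map φ.hom.hom.hom 2 h = (d : ℂ) • h) (h11 : IsOfHodgeType A.dim A.X 2 1 1 h)
    (hvol : ((⋀[ℂ]^2 (complexBetti A.X 1)).subtype ((abelianVarietyCohomologyExteriorH1_holds.equiv A 2).symm h)) ^ (n + n) ≠ 0)
    {cP cQ : complexBetti A.X (2 * n)} (hcP : cP ∈ weilClassesPlus A φ n d) (hcP0 : cP ≠ 0)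
    (hcQ : cQ ∈ weilClassesMinus A φ n d) (hcQ0 : cQ ≠ 0)
    (Aₛ : ℂ) {Bₛ la : ℂ} (hBs : Bₛ ≠ 0) (hla : la ≠ 0) (hn : 2 ≤ n) {t : ℂ}
    (ht : (((n + n).factorial : ℕ) : ℂ) • ((⋀[ℂ]^(2 * n) (complexBetti A.X 1)).subtype ((abelianVarietyCohomologyExteriorH1_holds.equiv A (2 * n)).symm cP) *
        (⋀[ℂ]^(2 * n) (complexBetti A.X 1)).subtype ((abelianVarietyCohomologyExteriorH1_holds.equiv A (2 * n)).symm cQ)) =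
      t • ((⋀[ℂ]^2 (complexBetti A.X 1)).subtype ((abelianVarietyCohomologyExteriorH1_holds.equiv A 2).symm h)) ^ (n + n)) :
    finrank ℂ ↥(S ℂ (hodgeZeroOne hA) n
        ((∑ m ∈ Finset.range (n + n + 1), (((Aₛ + Bₛ * (m : ℂ)) * la ^ m) * ((m.factorial : ℕ) : ℂ)⁻¹) •
            ((⋀[ℂ]^2 (complexBetti A.X 1)).subtype ((abelianVarietyCohomologyExteriorH1_holds.equiv A 2).symm h)) ^ m) +
          (⋀[ℂ]^(2 * n) (complexBetti A.X 1)).subtype ((abelianVarietyCohomologyExteriorH1_holds.equiv A (2 * n)).symm cP) +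
          (⋀[ℂ]^(2 * n) (complexBetti A.X 1)).subtype ((abelianVarietyCohomologyExteriorH1_holds.equiv A (2 * n)).symm cQ))) + 4 = 4 * (n + n).choose n := by
  haveI : Module.Finite ℂ (complexBetti A.X 1) := abelianVarietyCohomologyExteriorH1_holds.finite_one A
  have ht0 := pin_ne_zero_weilType hA hdim hd hφ hP hQ hp hh h11 hvol hcP hcP0 hcQ hcQ0 ht
  have h : finrank ℂ ↥(S ℂ (hodgeZeroOne hA) n
        ((∑ m ∈ Finset.range (n + n + 1), (((Aₛ + Bₛ * (m : ℂ)) * la ^ m) * ((m.factorial : ℕ) : ℂ)⁻¹) •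
            ((⋀[ℂ]^2 (complexBetti A.X 1)).subtype ((abelianVarietyCohomologyExteriorH1_holds.equiv A 2).symm h)) ^ m) +
          (⋀[ℂ]^(2 * n) (complexBetti A.X 1)).subtype ((abelianVarietyCohomologyExteriorH1_holds.equiv A (2 * n)).symm cP) +
          (⋀[ℂ]^(2 * n) (complexBetti A.X 1)).subtype ((abelianVarietyCohomologyExteriorH1_holds.equiv A (2 * n)).symm cQ))) +
        2 * (hankel1 ℂ (n + n) n (fun m => (Aₛ + Bₛ * (m : ℂ)) * la ^ m)).rank +
        finrank ℂ ↥(LinearMap.ker (Matrix.toLin' (Mod4.middleM n (fun m => (Aₛ + Bₛ * (m : ℂ)) * la ^ m)) - t • LinearMap.id)) =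
      ((hankel1 ℂ (n + n) n (fun m => (Aₛ + Bₛ * (m : ℂ)) * la ^ m)).rank + 2) * (n + n).choose n :=
    finrank_S_weilType_middle hA hdim hd hφ hP hQ hp hh h11 hvol hcP hcP0 hcQ hcQ0 (by omega) (fun m => (Aₛ + Bₛ * (m : ℂ)) * la ^ m) ht
  rw [Mod4.hankel1_rank_confluent (by omega) (by omega) Aₛ hBs hla, Mod4.finrank_ker_middleM_confluent hn Aₛ Bₛ la ht0] at h
  omega

end RealCarrier

end Summit.Ventures.HSemireg.WeilFrame

end
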